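import Summits.HodgeConjecture.CorCM.QuarticCMTypeReflection
import Literature.NumberTheory.ComplexMultiplication.CMTypeRankFamilies
import Literature.NumberTheory.ComplexMultiplication.CMFieldConjSquareQuadraticSubfields
import HarnessLib

/-!
# CM types of a QUARTIC CM field, IV: for `K/ℚ` not Galois, complex conjugation on `Hom(K, ℂ)` is the SQUARE of an
# automorphism of `ℂ`; the Galois closure of `K` contains no imaginary quadratic field

COR-CM (cell `pub-hodgecm2`), seat p2 (gen 16), count-neutral claim IQD4 — the DIHEDRAL twin of
`Literature.NumberTheory.ComplexMultiplication.CMFieldConjSquareQuadraticSubfields` (seat b23: for a CM field that is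
Galois over `ℚ` with CYCLIC group of order `≡ 0 (mod 4)`, complex conjugation is a square in the Galois group, so the
field contains no imaginary quadratic subfield).  Here `K` is a quartic CM field that is NOT Galois over `ℚ` (its Galois
closure is dihedral of order `8`); everything is phrased, as in `CorCM/QuarticCMTypeReflection` (seat b24), through the
action of `Aut(ℂ)` on the four embeddings `Hom(K, ℂ) = {a, ā, b, b̄}` by composition (scoped `ringEquivCompAction`),
and the Galois closure is never named in the proofs.  Everything is PROVED; theorems only; no definition, no named fact.

* §1 **`exists_ringAut_smul_smul_eq_conjugate`** — `K` quartic CM, `K/ℚ` not Galois ⟹ some `τ ∈ Aut(ℂ)` has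
  `τ ∘ τ ∘ s = s̄` for every `s : K → ℂ`.  Proof: transitivity of `Aut(ℂ)` on `Hom(K, ℂ)`
  (`Pohlmann1968.isPretransitive_ringEquiv_complex`) gives `g` with `g ∘ a = b`; then `g ∘ b ∈ {a, ā}`, and either `g`
  itself (`g ∘ b = ā`) or `g ∘ τ₀` (`g ∘ b = a`, `τ₀` = b24's REFLECTION `τ₀ ∘ a = a`, `τ₀ ∘ b = b̄`,
  `QuarticCM.exists_ringAut_smul_eq_self_smul_eq_conjugate_of_not_isGalois`) is the `4`-cycle `(a b ā b̄)`, whose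
  square is `(a ā)(b b̄)`.  (In the dihedral group `D₄ = C_{S₄}((a ā)(b b̄))` through which `Aut(ℂ)` acts, the
  central involution is the square of the `4`-cycles.)
* §2 an imaginary quadratic partner `k` (`[k:ℚ] = 2`, CM): every `γ ∈ Aut(ℂ)` acts on `Hom(k, ℂ) = {t, t̄}` trivially or
  as complex conjugation (`smul_eq_self_or_eq_conjugate_of_finrank_eq_two`), so `γ ∘ γ` acts trivially
  (`smul_smul_eq_self_of_finrank_eq_two`); hence **`exists_ringAut_smul_eq_conjugate_smul_eq_self`**: some
  automorphism of `ℂ` (namely `ρ ∘ τ ∘ τ`) acts as COMPLEX CONJUGATION on `Hom(k, ℂ)` and TRIVIALLY on `Hom(K, ℂ)`.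
* §3 **`slotwiseIndependent_of_two_slots`** — the abstract two-slot criterion for
  `ComplexMultiplication.SlotwiseIndependent`: if every group element acts on the slot `E_{i₀}` either trivially or as a
  fixed involution `ρ`, and some `τ₁` acts as `ρ` on `E_{i₀}` and trivially on `E_{i₁}`, the action on `(E_{i₀}, E_{i₁})`
  is slotwise independent (consumed by `CorCM/ImaginaryQuadraticTimesNonGaloisQuarticCMHodge`).
* §4 **`normalClosure_inf_normalClosure_eq_bot_of_not_isGalois`** — for `k` imaginary quadratic and `K` a non-Galois
  quartic CM field, `normalClosure ℚ k ℂ ⊓ normalClosure ℚ K ℂ = ⊥`: the automorphism of §2 fixes the Galois closure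
  of `K` pointwise and induces complex conjugation on that of `k`, so a common element is real, and the only real
  subfield of an imaginary quadratic field is `ℚ` — the classical "the Galois closure of a non-normal quartic CM field
  (a dihedral CM field of degree `8`) has only REAL quadratic subfields", i.e. the hypothesis of
  `CorCM/LinearlyDisjointCMFieldsHodge.hodgeConjectureFor_prod_of_normalClosure_inf_eq_bot` for the pair `(k, K)`.

Print counterparts: the three Galois types of a quartic CM field (cyclic, biquadratic, non-normal with dihedral closure)
are in Shimura §8.4 (2) Example and Moonen–Zarhin 1999, section "Hodge groups of simple abelian surfaces of CM-type";
Gordon's survey §3 Theorem is the mechanism by which linear disjointness feeds the Hodge conjecture on products.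

## References
* [Shimura1998] G. Shimura, *Abelian Varieties with Complex Multiplication and Modular Functions*, §8.4 (2).
* [MoonenZarhin1999LowDim] B. Moonen, Yu. Zarhin, Math. Ann. 315 (1999) 711–733, section "Hodge groups of simple
  abelian surfaces of CM-type".
* [Gordon1999HodgeAVSurvey] B. B. Gordon, *A survey of the Hodge conjecture for abelian varieties*, §3 Theorem (proof).
* [Lang2002] S. Lang, *Algebra*, 3rd ed., VI §1 Cor. 1.4 (Galois correspondence), V §3 Thm. 3.3.
-/

noncomputable section

open NumberField NumberField.ComplexEmbedding IntermediateField

namespace Summit.HodgeConjecture.CorCM.QuarticCM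

open Literature.NumberTheory.ComplexMultiplication
open Literature.AlgebraicGeometry.Pohlmann1968

/-! ## §1 `K/ℚ` not Galois: complex conjugation on `Hom(K, ℂ)` is the square of a `4`-cycle -/

section Quartic

variable {K : Type} [Field K] [NumberField K] [IsCMField K]

omit [IsCMField K] in
/-- A quartic field has an embedding outside any pair `{a, ā}` (there are four embeddings). [folklore] -/
theorem exists_ne_ne_conjugate (h4 : Module.finrank ℚ K = 4) (a : K →+* ℂ) :
    ∃ b : K →+* ℂ, b ≠ a ∧ b ≠ conjugate a := by
  classical
  by_contra h
  push Not at h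
  have hsub : (Finset.univ : Finset (K →+* ℂ)) ⊆ {a, conjugate a} := fun s _ => by
    by_cases hs : s = a
    · simp [hs]
    · simp [h s hs]
  have hle := Finset.card_le_card hsub
  rw [Finset.card_univ, card_ringHom_eq_four h4] at hle
  exact absurd (hle.trans Finset.card_le_two) (by norm_num)

/-- **A `4`-cycle in the image of `Aut(ℂ)`.**  For a quartic CM field `K` that is NOT Galois over `ℚ` and embeddings
`b ∉ {a, ā}`, some `τ ∈ Aut(ℂ)` has `τ ∘ a = b` and `τ ∘ b = ā` (so `τ` permutes the four embeddings cyclically as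
`(a b ā b̄)`): a `g` with `g ∘ a = b` exists by transitivity, `g ∘ b ∈ {a, ā}`, and if `g ∘ b = a` one composes with the
reflection `τ₀` (`τ₀ ∘ a = a`, `τ₀ ∘ b = b̄`) of `QuarticCMTypeReflection` §3. [cite: Shimura1998, §8.4 (2)] -/
theorem exists_ringAut_smul_eq_smul_eq_conjugate (h4 : Module.finrank ℚ K = 4) (hK : ¬IsGalois ℚ K) {a b : K →+* ℂ}
    (hba : b ≠ a) (hba' : b ≠ conjugate a) : ∃ τ : ℂ ≃+* ℂ, τ • a = b ∧ τ • b = conjugate a := by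
  haveI := isPretransitive_ringEquiv_complex (K := K)
  obtain ⟨g, hg⟩ := MulAction.exists_smul_eq (ℂ ≃+* ℂ) a b
  have hg' : g • conjugate a = conjugate b := by rw [smul_conjugate, hg]
  rcases eq_or_eq_or_eq_or_eq h4 hba hba' (g • b) with h | h | h | h
  · obtain ⟨τ₀, hτ₀a, hτ₀b⟩ := exists_ringAut_smul_eq_self_smul_eq_conjugate_of_not_isGalois h4 hK hba hba'
    refine ⟨g * τ₀, ?_, ?_⟩
    · rw [mul_smul, hτ₀a, hg]
    · rw [mul_smul, hτ₀b, smul_conjugate, h]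
  · exact ⟨g, hg, h⟩
  · exact absurd (smul_left_cancel g (h.trans hg.symm)) hba
  · exact absurd (smul_left_cancel g (h.trans hg'.symm)) hba'

/-- **Complex conjugation on `Hom(K, ℂ)` is a square in the image of `Aut(ℂ)`** for a quartic CM field `K` that is
NOT Galois over `ℚ`: some `τ ∈ Aut(ℂ)` has `τ ∘ τ ∘ s = s̄` for all four embeddings `s` (the square of the `4`-cycle
`(a b ā b̄)` is `(a ā)(b b̄)`; in the dihedral group of order `8` through which `Aut(ℂ)` acts, the central involution is
a square). [cite: Shimura1998, §8.4 (2)] -/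
theorem exists_ringAut_smul_smul_eq_conjugate (h4 : Module.finrank ℚ K = 4) (hK : ¬IsGalois ℚ K) :
    ∃ τ : ℂ ≃+* ℂ, ∀ s : K →+* ℂ, τ • τ • s = conjugate s := by
  obtain ⟨a⟩ : Nonempty (K →+* ℂ) := inferInstance
  obtain ⟨b, hba, hba'⟩ := exists_ne_ne_conjugate h4 a
  obtain ⟨τ, hτa, hτb⟩ := exists_ringAut_smul_eq_smul_eq_conjugate h4 hK hba hba'
  have hτa' : τ • conjugate a = conjugate b := by rw [smul_conjugate, hτa]
  have hτb' : τ • conjugate b = a := by rw [smul_conjugate, hτb, involutive_conjugate K a]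
  refine ⟨τ, fun s => ?_⟩
  rcases eq_or_eq_or_eq_or_eq h4 hba hba' s with rfl | rfl | rfl | rfl
  · rw [hτa, hτb]
  · rw [hτa', hτb', involutive_conjugate K a]
  · rw [hτb, hτa']
  · rw [hτb', hτa, involutive_conjugate K b]

end Quartic

/-! ## §2 An imaginary quadratic partner: `Aut(ℂ)` acts on its two embeddings through `{1, ρ}` -/

section Quadratic

variable {k : Type} [Field k] [NumberField k] [IsCMField k]

/-- `Hom(k, ℂ) = {t, t̄}` for an imaginary quadratic field `k` (two embeddings, `t̄ ≠ t`); cf.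
`QuarticCM.eq_or_eq_conjugate_of_quadratic` in `CorCM/QuadraticCMTypeSlice` (same statement, heavier imports). [folklore] -/
theorem eq_or_eq_conjugate_of_finrank_eq_two (h2 : Module.finrank ℚ k = 2) (t s : k →+* ℂ) :
    s = t ∨ s = conjugate t := by
  classical
  by_contra h
  rw [not_or] at h
  have hcard : ({s, t, conjugate t} : Finset (k →+* ℂ)).card = 3 := by
    rw [Finset.card_insert_of_notMem (by simp [h.1, h.2]), Finset.card_pair (conjugate_ne t).symm]
  have hle : ({s, t, conjugate t} : Finset (k →+* ℂ)).card ≤ Fintype.card (k →+* ℂ) := Finset.card_le_univ _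
  rw [hcard, Embeddings.card, h2] at hle
  exact absurd hle (by norm_num)

/-- **Every automorphism of `ℂ` acts on the two embeddings of an imaginary quadratic field either trivially or as
complex conjugation.** [folklore] -/
theorem smul_eq_self_or_eq_conjugate_of_finrank_eq_two (h2 : Module.finrank ℚ k = 2) (γ : ℂ ≃+* ℂ) :
    (∀ t : k →+* ℂ, γ • t = t) ∨ ∀ t : k →+* ℂ, γ • t = conjugate t := by
  obtain ⟨t₀⟩ : Nonempty (k →+* ℂ) := inferInstance
  rcases eq_or_eq_conjugate_of_finrank_eq_two h2 t₀ (γ • t₀) with h | h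
  · refine Or.inl fun t => ?_
    rcases eq_or_eq_conjugate_of_finrank_eq_two h2 t₀ t with rfl | rfl
    · exact h
    · rw [smul_conjugate, h]
  · refine Or.inr fun t => ?_
    rcases eq_or_eq_conjugate_of_finrank_eq_two h2 t₀ t with rfl | rfl
    · exact h
    · rw [smul_conjugate, h, involutive_conjugate k t₀]

/-- The square of every automorphism of `ℂ` fixes both embeddings of an imaginary quadratic field. [folklore] -/
theorem smul_smul_eq_self_of_finrank_eq_two (h2 : Module.finrank ℚ k = 2) (γ : ℂ ≃+* ℂ) (t : k →+* ℂ) :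
    γ • γ • t = t := by
  rcases smul_eq_self_or_eq_conjugate_of_finrank_eq_two h2 γ with h | h
  · rw [h t, h t]
  · rw [h t, smul_conjugate, h t, involutive_conjugate k t]

variable {K : Type} [Field K] [NumberField K] [IsCMField K]

/-- **An automorphism of `ℂ` that is complex conjugation on `Hom(k, ℂ)` and the identity on `Hom(K, ℂ)`**, for `k`
imaginary quadratic and `K` a quartic CM field NOT Galois over `ℚ`: with `τ` as in
`exists_ringAut_smul_smul_eq_conjugate`, the automorphism `ρ ∘ τ ∘ τ` (`ρ` = complex conjugation) does it. This is the
element "acting as `−1` on one component and `+1` on the other" of Gordon's §3 proof, for the pair `(k, K)`.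
[cite: Gordon1999HodgeAVSurvey, §3 Theorem (proof)] -/
theorem exists_ringAut_smul_eq_conjugate_smul_eq_self (h2 : Module.finrank ℚ k = 2) (h4 : Module.finrank ℚ K = 4)
    (hK : ¬IsGalois ℚ K) :
    ∃ τ : ℂ ≃+* ℂ, (∀ t : k →+* ℂ, τ • t = conjugate t) ∧ ∀ s : K →+* ℂ, τ • s = s := by
  obtain ⟨τ, hτ⟩ := exists_ringAut_smul_smul_eq_conjugate h4 hK
  refine ⟨starRingAut * (τ * τ), fun t => ?_, fun s => ?_⟩
  · rw [mul_smul, mul_smul, smul_smul_eq_self_of_finrank_eq_two h2, conj_smul_eq_conjugate]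
  · rw [mul_smul, mul_smul, hτ, conj_smul_eq_conjugate, involutive_conjugate K s]

end Quadratic

/-! ## §3 The abstract two-slot criterion for slotwise independence -/

/-- **Two-slot criterion.**  Let a group `G` act on the slots `E_{i₀}`, `E_{i₁}` of a two-element family.  If every
`g ∈ G` acts on `E_{i₀}` either trivially or as a fixed involution `ρ`, and some `τ₁ ∈ G` acts as `ρ` on `E_{i₀}` and
trivially on `E_{i₁}`, then the action is slotwise independent: on the slot `i₀` use `1` or `τ₁`; on the slot `i₁` use
`g` or `g τ₁`. [cite: Gordon1999HodgeAVSurvey, §3 Theorem (proof)] -/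
theorem slotwiseIndependent_of_two_slots {G : Type*} [Group G] {I : Type*} {E : I → Type*}
    [∀ i, MulAction G (E i)] {i₀ i₁ : I} (hI : ∀ j, j = i₀ ∨ j = i₁) (ρ τ₁ : G)
    (hdich : ∀ g : G, (∀ s : E i₀, g • s = s) ∨ ∀ s : E i₀, g • s = ρ • s) (hρρ : ∀ s : E i₀, ρ • ρ • s = s)
    (h₁ : ∀ s : E i₀, τ₁ • s = ρ • s) (h₁' : ∀ s : E i₁, τ₁ • s = s) : SlotwiseIndependent G E := by
  intro i g
  rcases hI i with rfl | rfl
  · rcases hdich g with hg | hg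
    · exact ⟨1, fun s => by rw [one_smul, hg], fun j _ s => one_smul _ _⟩
    · refine ⟨τ₁, fun s => by rw [h₁, hg], fun j hj s => ?_⟩
      rcases hI j with rfl | rfl
      · exact absurd rfl hj
      · exact h₁' s
  · rcases hdich g with hg | hg
    · refine ⟨g, fun s => rfl, fun j hj s => ?_⟩
      rcases hI j with rfl | rfl
      · exact hg s
      · exact absurd rfl hj
    · refine ⟨g * τ₁, fun s => by rw [mul_smul, h₁'], fun j hj s => ?_⟩
      rcases hI j with rfl | rfl
      · rw [mul_smul, h₁, hg, hρρ]
      · exact absurd rfl hj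

/-! ## §4 The Galois closures of `k` and `K` meet in `ℚ` -/

section NormalClosure

variable {k : Type} [Field k] [NumberField k] [IsCMField k]
variable {K : Type} [Field K] [NumberField K] [IsCMField K]

omit [IsCMField K] in
/-- An automorphism of `ℂ` fixing every embedding of `K` fixes the Galois closure `normalClosure ℚ K ℂ` pointwise
(it is generated by the images of the embeddings). [cite: Lang2002, V §3 Thm. 3.3] -/
theorem apply_eq_self_of_mem_normalClosure {τ : ℂ ≃+* ℂ} (hτ : ∀ s : K →+* ℂ, τ • s = s) {x : ℂ}
    (hx : x ∈ normalClosure ℚ K ℂ) : τ x = x := by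
  let τ' : ℂ ≃ₐ[ℚ] ℂ := AlgEquiv.ofRingEquiv (f := τ) fun q => by simp
  have hle : normalClosure ℚ K ℂ ≤ fixedField (Subgroup.zpowers τ') := by
    refine normalClosure_le_iff.2 fun f => ?_
    rintro _ ⟨y, rfl⟩
    rw [mem_fixedField_iff]
    intro g hg
    have hfix : τ' (f y) = f y := by
      have h := RingHom.congr_fun (hτ f.toRingHom) y
      change τ (f y) = f y
      simpa using h
    have hst : Subgroup.zpowers τ' ≤ MulAction.stabilizer (ℂ ≃ₐ[ℚ] ℂ) ((f : K →ₐ[ℚ] ℂ) y) :=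
      (Subgroup.zpowers_le (G := ℂ ≃ₐ[ℚ] ℂ)).2 (MulAction.mem_stabilizer_iff.2 hfix)
    exact MulAction.mem_stabilizer_iff.1 (hst hg)
  have h := (mem_fixedField_iff _ _).1 (hle hx) τ' (Subgroup.mem_zpowers τ')
  exact h

omit [IsCMField k] in
/-- An automorphism of `ℂ` acting as complex conjugation on every embedding of `k` is complex conjugation on the
Galois closure `normalClosure ℚ k ℂ`. [cite: Lang2002, V §3 Thm. 3.3] -/
theorem apply_eq_conj_of_mem_normalClosure {τ : ℂ ≃+* ℂ} (hτ : ∀ t : k →+* ℂ, τ • t = conjugate t) {x : ℂ}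
    (hx : x ∈ normalClosure ℚ k ℂ) : τ x = starRingEnd ℂ x := by
  have hτ' : ∀ t : k →+* ℂ, (starRingAut * τ) • t = t := fun t => by
    rw [mul_smul, hτ, conj_smul_eq_conjugate, involutive_conjugate k t]
  have h := apply_eq_self_of_mem_normalClosure hτ' hx
  have h' : starRingEnd ℂ (τ x) = x := h
  rw [← Complex.conj_conj (τ x), h']

/-- **The Galois closures in `ℂ` of an imaginary quadratic field `k` and of a quartic CM field `K` that is NOT
Galois over `ℚ` meet in `ℚ`**: `normalClosure ℚ k ℂ ⊓ normalClosure ℚ K ℂ = ⊥` — the dihedral Galois closure of `K`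
has only real quadratic subfields.  (The automorphism of `exists_ringAut_smul_eq_conjugate_smul_eq_self` is the
identity on the closure of `K` and complex conjugation on that of `k`; a nonzero intersection would be all of the
quadratic `normalClosure ℚ k ℂ`, on which conjugation is not the identity.)  This is the hypothesis of
`LinearlyDisjointCMFieldsHodge.hodgeConjectureFor_prod_of_normalClosure_inf_eq_bot` for the pair `(k, K)`.
[cite: Shimura1998, §8.4 (2)] [cite: Lang2002, VI §1 Cor. 1.4] -/
theorem normalClosure_inf_normalClosure_eq_bot_of_not_isGalois (h2 : Module.finrank ℚ k = 2)
    (h4 : Module.finrank ℚ K = 4) (hK : ¬IsGalois ℚ K) :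
    normalClosure ℚ k ℂ ⊓ normalClosure ℚ K ℂ = ⊥ := by
  obtain ⟨τ, hτk, hτK⟩ := exists_ringAut_smul_eq_conjugate_smul_eq_self h2 h4 hK
  haveI : Algebra.IsQuadraticExtension ℚ k := { finrank_eq_two' := h2 }
  by_contra hne
  have hfin : Module.finrank ℚ (normalClosure ℚ k ℂ) = 2 := by rw [finrank_normalClosure_of_normal, h2]
  haveI : FiniteDimensional ℚ (normalClosure ℚ k ℂ) := Module.finite_of_finrank_pos (by rw [hfin]; norm_num)
  have hdvd : Module.finrank ℚ ↥(normalClosure ℚ k ℂ ⊓ normalClosure ℚ K ℂ) ∣ 2 :=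
    hfin ▸ finrank_dvd_of_le_right (inf_le_left : normalClosure ℚ k ℂ ⊓ normalClosure ℚ K ℂ ≤ _)
  have h1 : Module.finrank ℚ ↥(normalClosure ℚ k ℂ ⊓ normalClosure ℚ K ℂ) ≠ 1 := fun h =>
    hne (finrank_eq_one_iff.1 h)
  have h2' : Module.finrank ℚ ↥(normalClosure ℚ k ℂ ⊓ normalClosure ℚ K ℂ) = 2 := by
    rcases (Nat.dvd_prime Nat.prime_two).1 hdvd with h | h
    · exact absurd h h1
    · exact h
  have hle : normalClosure ℚ k ℂ ≤ normalClosure ℚ K ℂ :=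
    inf_eq_left.1 (eq_of_le_of_finrank_eq inf_le_left (by rw [h2', hfin]))
  -- every element of the closure of `k` is then fixed by `τ` AND conjugated by `τ`, hence real: `k` would be real
  obtain ⟨t⟩ : Nonempty (k →+* ℂ) := inferInstance
  have hreal : ComplexEmbedding.IsReal t := by
    rw [ComplexEmbedding.isReal_iff]
    refine RingHom.ext fun z => ?_
    have hz : t z ∈ normalClosure ℚ k ℂ := apply_mem_normalClosure (I := Unit) (K := fun _ => k) () t z
    rw [conjugate_coe_eq, ← apply_eq_conj_of_mem_normalClosure hτk hz,
      apply_eq_self_of_mem_normalClosure hτK (hle hz)]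
  exact IsTotallyComplex.complexEmbedding_not_isReal t hreal

/-- Symmetric form: `normalClosure ℚ K ℂ ⊓ normalClosure ℚ k ℂ = ⊥`. [cite: Shimura1998, §8.4 (2)] -/
theorem normalClosure_inf_normalClosure_eq_bot_of_not_isGalois' (h2 : Module.finrank ℚ k = 2)
    (h4 : Module.finrank ℚ K = 4) (hK : ¬IsGalois ℚ K) :
    normalClosure ℚ K ℂ ⊓ normalClosure ℚ k ℂ = ⊥ := by
  rw [inf_comm]
  exact normalClosure_inf_normalClosure_eq_bot_of_not_isGalois h2 h4 hK

end NormalClosure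

end Summit.HodgeConjecture.CorCM.QuarticCM

end
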